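import Mathlib
import Summits.ResolutionOfSingularities.ResolutionOfSingularities.Theorems.WildQuotientsWildQuotientResolutionCentreInertia
import Summits.ResolutionOfSingularities.ResolutionOfSingularities.Theorems.WildQuotientsWildQuotientResolutionExtensionBelow
import HarnessLib

/-!
# Automorphisms fixing a maximal ideal of the INTEGRAL CLOSURE of a valuation ring and acting trivially modulo it
# form a p-closed group (crux `WildQuotients.WildQuotientResolution`, stub `stub_phaseZeroHighDim`: (H1) port,
# terminal step in the integral-closure interface)

Crux stmt-ResolutionOfSingularities-15640 (`WildQuotientResolution`), registered stub `stub_phaseZeroHighDim`,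
residual (H1) = Abbes–Saito 2011 Prop. 2.22. ✓`CentreInertia.hasNormalSylow_of_centre` is phrased with the ring
`B = ⋂ {W' : W' ∩ K = W ∩ K}` of all extensions of the valuation ring `W ∩ K`; the assembler of the Zariski-local
form of AS Lemma 2.21 (evidence memo PHASE0-H1-PORTPLAN.md §2b) meets instead the INTEGRAL CLOSURE of `W ∩ K` in
`L` (stalks of relative normalisations). By ✓`ExtensionBelow` (going down for valuation rings + Mathlib's
`iInf_valuationSubring_superset`) the two rings coincide, so the hypotheses may be checked on integral elements:

* `hasNormalSylow_of_centre_of_isIntegral` — `L/K` finite, `W` a valuation ring of `L` of residue characteristic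
  `p`, `N` = the integral closure in `L` of (the subring generated by the image of) `W ∩ K`; a subgroup of
  `Gal(L/K)` whose elements map `𝔪_W ∩ N` into `𝔪_W` and satisfy `|g b − b|_W < 1` for `b ∈ N` is p-closed.

[OURS · crux stmt-ResolutionOfSingularities-15640 · helper toward `stub_phaseZeroHighDim`; counted 0; AI-level work,
weaker than expert review.] [cite: AbbesSaito2011, Lemma 2.10, Lemma 2.21] [cite: ZariskiSamuel1960, Ch. VI §7, §12]
-/

-- single-problem summit: the doubled namespace component `ResolutionOfSingularities` is forced
set_option linter.dupNamespace false

noncomputable section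

open Literature.AlgebraicGeometry.Ramification

namespace Summit.ResolutionOfSingularities.ResolutionOfSingularities.Theorems.WildQuotientResolution.CentreInertia

universe u

variable {K L : Type u} [Field K] [Field L] [Algebra K L]

/-- **Integral-closure form of `hasNormalSylow_of_centre`.** Let `L/K` be finite, `W` a valuation ring of `L`
with residue field of characteristic `p`, and `N` the integral closure in `L` of the subring generated by the
image of `V₀ = W ∩ K`. A subgroup `H ≤ Gal(L/K)` whose elements map the centre `𝔪_W ∩ N` into `𝔪_W` and
satisfy `|g b − b|_W < 1` for all `b ∈ N` has a normal Sylow `p`-subgroup.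
[cite: AbbesSaito2011, Lemma 2.10, Lemma 2.21] [cite: ZariskiSamuel1960, Ch. VI §7, §12] -/
theorem hasNormalSylow_of_centre_of_isIntegral [FiniteDimensional K L] {p : ℕ} [Fact p.Prime]
    (W : ValuationSubring L) [CharP (IsLocalRing.ResidueField W) p] (H : Subgroup (L ≃ₐ[K] L))
    (hM : ∀ g ∈ H, ∀ b : L,
      b ∈ integralClosure (Subring.closure
        (algebraMap K L '' (W.comap (algebraMap K L) : Set K))) L →
      W.valuation b < 1 → W.valuation (g b) < 1)
    (hres : ∀ g ∈ H, ∀ b : L,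
      b ∈ integralClosure (Subring.closure
        (algebraMap K L '' (W.comap (algebraMap K L) : Set K))) L →
      W.valuation (g b - b) < 1) :
    HasNormalSylow p H := by
  refine hasNormalSylow_of_centre W H (fun g hg b hb => hM g hg b ?_) (fun g hg b hb => hres g hg b ?_)
  · exact ExtensionBelow.mem_integralClosure_of_forall_mem_extension (W.comap (algebraMap K L)) hb
  · exact ExtensionBelow.mem_integralClosure_of_forall_mem_extension (W.comap (algebraMap K L)) hb

end Summit.ResolutionOfSingularities.ResolutionOfSingularities.Theorems.WildQuotientResolution.CentreInertia

end
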